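import Literature.Analysis.FluidPDE.PeriodicGalileanFrameBlowup
import HarnessLib

/-!
# Barrier: the unnormalised-pressure (Galilean) loophole of the printed periodic Clay problems
# (Tao 2013, §1 after Prop. 1.7, §3 eq. (galilean), §4)

Barrier catalogue entry for `NavierStokesRegularity` (D-0021), filed by the D-0090 NS-CLAIMS cell
(salvage seat `ns-claims-salvage-p2`) at the METHOD level, for the technique class
«re-interpretation of the problem statement: non-periodic pressure / frame-dependent or
state-dependent force» (cell MAP-SCHEMA T9, with the T3 ingredient «explicit accelerated-frame
family»). Instance adjudicated in the cell: C02, J. Jormakka, EJDE 2010/93 (skeleton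
`Literature.Claims.NS.Jormakka2010`; kernel files `Theorems/SoloRefuteJormakka2010*.lean`,
`Theorems/SoloSalvageJormakka2010*.lean`).

## What is printed (Tao, Anal. PDE 6 (2013) = arXiv:1108.1165)

* §1, after Prop. 1.7 (arXiv Prop. 7): "there is a technical quirk in the inhomogeneous periodic
  problem as formulated in Conjecture 1.6, due to the fact that the pressure `p` is not required to
  be periodic. This opens up a Galilean invariance in the problem which allows one to homogenise
  away the role of the forcing term. … Proposition 1.7 exploits the technical loophole of
  non-periodic pressure. The same loophole can also be used to easily demonstrate failure of
  uniqueness for the periodic Navier-Stokes problem … This suggests that in the non-homogeneous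
  case `f ≠ 0`, one needs an additional normalisation to “fix” the periodic Navier-Stokes problem";
  footnote: normalised pressure "is equivalent to requiring that the pressure be periodic"; "once
  one imposes the normalised pressure condition, then the periodic Navier-Stokes problem becomes
  locally well-posed in the smooth category (in particular, smooth solutions are now unique …)".
* §3, eq. (galilean): `ũ(t,x) = u(t, x − ∫₀ᵗ v) + v(t)`, `p̃(t,x) = p(t, x − ∫₀ᵗ v) − x · v′(t)`,
  "valid for any smooth function `v : ℝ → ℝ³` … preserves periodicity (recall here that in our
  definition of a periodic solution, the pressure was not required to be periodic) … It also
  clearly destroys the pressure normalisation property."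
* §4 ¶1 and Lemma 4.1 (ii) (arXiv Lemma 25): the symmetries "alter the velocity field `u` and
  pressure `p` without affecting the data `(u₀,f,T)`, thus leading to a breakdown of uniqueness";
  the pressure of a periodic smooth solution is the normalised pressure `+ x · a(t) + C(t)`.
* Fefferman's Clay text: (B)/(D) with (10) "u(x,t) = u(x+eⱼ,t)" as printed (pressure
  unconstrained; tree leaves `NavierStokesExistenceSmoothPeriodic`, `NavierStokesBreakdownPeriodic`)
  and the CMI errata page "The further condition `p(x+eⱼ,t) = p(x,t)` should be made explicit"
  (erratum leaf `NavierStokesBreakdownPeriodicPressurePeriodic`; schema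
  `Literature.Claims.NS.ClayVariants.clayPeriodic` / `clayPeriodicErrata`).

## What is formalised (all three conjuncts are theorems of the tree, std axioms)

`UnnormalisedPressureLoophole` is the conjunction, on `ℝ³ = EuclideanSpace ℝ (Fin 3)`, of
(i) `Literature.Analysis.FluidPDE.setOf_periodicSolution_infinite` — one global smooth `u`-periodic
solution of the unforced problem `(ν, u₀)` ⇒ infinitely many with the same datum (the accelerated
frames `ξ_c(t) = ct²w`); (ii) `isLatticePeriodic_galileanBoost_pressure_iff` — the boosted
pressure slice is periodic iff `ξ″(t) = 0`: the errata class admits no accelerated frame;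
(iii) `exists_periodic_nonContinuable_and_global` — for every `ν` and `a > 0` there is a
classical `u`-periodic solution on `[0, a)` with datum `0` that has NO continuation smooth on
`ℝ³ × [0,∞)`, while the same data (`u₀ = 0`, `f = 0`) have a global smooth solution with `u`
and `p` periodic. `unnormalisedPressureLoophole_holds` proves it.

## References

* [Tao2013Localisation] T. Tao, Anal. PDE 6 (2013) 25–107 (arXiv:1108.1165): §1 after Prop. 1.7
  (arXiv Prop. 7), §3 eq. (galilean), §4 ¶1, Lemma 4.1 (ii) (arXiv Lemma 25), Conj. 1.8
  (normalised pressure), Thm. 5.1 (arXiv Thm. (lwp-h1): local well-posedness with normalised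
  pressure).
* [FeffermanClay2006] C. L. Fefferman, CMI problem description: (B), (D), (8)–(11), errata page.
* [Jormakka2010] J. Jormakka, Electron. J. Differential Equations 2010/93 (the adjudicated
  instance: Lemma 2.1, Thms. 2.2–2.4; cell verdict: first failing step `Step24UniqueLocal`
  p. 5, class false lemma; downstream LOGIC ↛ (D), class wrong problem, axes Δ3 FORCE / Δ6).
* [MajdaBertozzi2002] §1.2 (Galilean invariance; tree `IsClassicalNSSolutionOn.galileanBoost`).
-/

noncomputable section

open Set Filter
open scoped Topology RealInnerProductSpace

namespace Literature.Barriers.NavierStokesRegularity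

open Literature.Analysis.FluidPDE

/-- **Barrier (Tao 2013, §1 after Prop. 1.7; §3 eq. (galilean); §4): the printed periodic Clay
class — condition (10) on `u` only, pressure unconstrained — carries the extended Galilean
symmetry `(u, p) ↦ (u(t, y + ξ t) − ξ′(t), p(t, y + ξ t) + ⟪ξ″(t), y⟫)`, which fixes the data
`(u₀, f ≡ 0)` whenever `ξ(0) = ξ′(0) = 0`.** Consequently (i) every unforced periodic Cauchy
problem with ONE global smooth `u`-periodic solution has infinitely many; (ii) the boosted pressure
is periodic iff the frame is unaccelerated, so the CMI-errata class (pressure periodic) excludes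
every accelerated member; (iii) already at the datum `u₀ = 0` there is, for every `ν` and every
`a > 0`, a smooth `u`-periodic solution on `[0, a)` that cannot be continued to a solution smooth
on `ℝ³ × [0,∞)` — coexisting with the global rest solution. This declaration is the conjunction
of the three tree theorems [cite: Tao2013Localisation, §1 (after Prop. 1.7), §3 eq. (galilean), §4 ¶1].

BARRIER (structured block, D-0021):
technique_class: problem-reinterpretation non-periodic-pressure unnormalised-pressure galilean-frame-family accelerated-frame-blowup feedback-force state-dependent-force single-representative-blowup periodic-nonuniqueness-argument wrong-problem-periodic
blocks: every argument toward the NEGATIVE periodic Clay statement (D) — printed leaf `NavierStokesBreakdownPeriodic` or erratum leaf `NavierStokesBreakdownPeriodicPressurePeriodic` — (or against (B)) of one of the shapes: (a) «there exist periodic data and ONE smooth `u`-periodic solution on `[0,T)` that cannot be smoothly continued to `[0,∞)`» (an ∃-statement over solutions, e.g. a member of an accelerated-frame family `u(t, x + g(t)e) − g′(t)e` with `g′ → ∞`): conjunct (iii) realises this shape at the ZERO datum with `f ≡ 0`, where the global rest solution exists, so it implies nothing of type (D), whose conclusion is `¬∃` over ALL smooth `u`-periodic global solutions [cite: FeffermanClay2006,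 statement (D) with (10) (11)]; (b) «uniqueness in the printed class selects the bad representative» — conjunct (i): in the printed class uniqueness fails for EVERY datum admitting a global smooth solution [cite: Tao2013Localisation, §4 ¶1]; (c) «a feedback / frame-dependent force `f = F[u]` makes the bad representative the only solution» — Clay's `f` is a function of `(x,t)` of class (8)–(9) fixed before the quantifier over `(p,u)` [cite: FeffermanClay2006, statement (D) with (8) (9)], and along any smooth global candidate the realised closed-loop "force" of such a scheme need not even be a function smooth on `ℝ³ × [0,∞)` (cell C02: `Summit.…Theorems.Jormakka2010.theorem24ClosedLoop_holds`, the excluded class is empty); (d) any use of the accelerated family against the ERRATA leaf: conjunct (ii), the accelerated members have non-periodic pressure `+⟪ξ″(t), y⟫` [cite: Tao2013Localisation, §3 eq. (galilean)].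
because: the Galilean symmetry with arbitrary smooth frame velocity maps smooth solutions to smooth solutions, preserves periodicity of `u` and the data, and changes `u` whenever `ξ′ ≠ 0` while making the pressure non-periodic whenever `ξ″ ≠ 0` [cite: Tao2013Localisation, §3 eq. (galilean)]; hence in the printed class the solution set of a solvable problem is an orbit, never a point, and frame acceleration alone produces finite-time unboundedness of a representative without any dynamics (conjunct (iii) is the image of the rest state) — "the technical loophole of non-periodic pressure" [cite: Tao2013Localisation, §1 (after Prop. 1.7)]; with normalised (= periodic) pressure smooth periodic solutions are unique and exist locally [cite: Tao2013Localisation, §1 (before Conj. 1.8)], so nothing of the loophole survives in the errata reading.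
evasions_known: (1) NONE toward (D): imposing the CMI erratum / Tao's pressure normalisation (tree: `clayPeriodicErrata`, erratum leaf `NavierStokesBreakdownPeriodicPressurePeriodic`; Tao's repaired Conj. 1.8) removes the symmetry — a genuine (D)-type argument must produce data for which NO smooth solution with periodic `u` AND `p` exists, i.e. defeat local well-posedness-plus-continuation in the normalised class [cite: Tao2013Localisation, §1 Conj. 1.8 and the remark before it]; (2) the loophole is REAL as a statement about the printed text: printed (D) is implied by nothing here but is weaker than intended only in appearance — printed (D) ⇒ errata (D) (`Literature.Analysis.FluidPDE.NavierStokesBreakdownPeriodic.pressurePeriodic`), and for `f ≡ 0` printed (B) ⇔ errata (B) by un-boosting the affine pressure part (Tao's Lemma 4.1 (ii); cell file `PeriodicPressureNormalisation`, ns-claims-lit-4, in progress) [cite: Tao2013Localisation, §4 Lemma 4.1]; (3) Prop. 1.7 itself (forcing can be homogenised away in the printed class) is a further consequence in print, not formalised here [cite: Tao2013Localisation, §1 Prop. 1.7].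
scope_caveats: (a) conjuncts (i)–(iii) are stated for the UNFORCED problem (`f ≡ 0`, any real `ν`) on `ℝ³` with `ℤ³`-periodicity in Fefferman's sense (fields on `ℝ³`, not on the torus); the symmetry lemma itself (`IsNavierStokesSolution.galileanBoost`) carries a general force `f ↦ f(t, y + ξ t)`; (b) smooth category only (Fefferman's (11)); nothing is said about weak/mild classes, where pressure normalisation is built into the notion of solution [cite: Tao2013Localisation, §4 Lemma 4.1 (i)]; (c) conjunct (iii) exhibits non-continuability by unboundedness of `u` at ONE point as `t → a⁻`; it is not a statement about vorticity or any frame-invariant quantity (all of which stay bounded along the family — the «blow-up» is kinematic); (d) the adjudicated instance C02 used the Beltrami datum `u⁰` of [cite: Jormakka2010, Lemma 2.1] instead of `u₀ = 0`; the cell's kernel files show the same three phenomena there (`lemma21_holds`, `theorem23Witness_holds`, `not_clayDInstance`, `not_step24UniqueLocal`).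
status: established; every conjunct proved in the tree (`unnormalisedPressureLoophole_holds`, standard axioms) -/
def UnnormalisedPressureLoophole : Prop :=
  (∀ (ν : ℝ) (u₀ : EuclideanSpace ℝ (Fin 3) → EuclideanSpace ℝ (Fin 3))
      (u : ℝ → EuclideanSpace ℝ (Fin 3) → EuclideanSpace ℝ (Fin 3))
      (p : ℝ → EuclideanSpace ℝ (Fin 3) → ℝ),
      IsNavierStokesSolution ν 0 u₀ u p → IsSmoothOnHalfSpace u → IsSmoothOnHalfSpace p →
        (∀ t, 0 ≤ t → IsLatticePeriodic (u t)) →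
          {q : (ℝ → EuclideanSpace ℝ (Fin 3) → EuclideanSpace ℝ (Fin 3)) ×
              (ℝ → EuclideanSpace ℝ (Fin 3) → ℝ) |
            IsSmoothOnHalfSpace q.1 ∧ IsSmoothOnHalfSpace q.2 ∧ IsNavierStokesSolution ν 0 u₀ q.1 q.2 ∧
              ∀ t, 0 ≤ t → IsLatticePeriodic (q.1 t)}.Infinite) ∧
  (∀ (p : ℝ → EuclideanSpace ℝ (Fin 3) → ℝ) (t : ℝ) (ξ : ℝ → EuclideanSpace ℝ (Fin 3)) (g : ℝ → ℝ),
      IsLatticePeriodic (p t) →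
        (IsLatticePeriodic ((fun s y => p s (y + ξ s) + ⟪deriv (deriv ξ) s, y⟫ - g s) t) ↔
          deriv (deriv ξ) t = 0)) ∧
  (∀ (ν : ℝ) (a : ℝ), 0 < a →
      ∃ (u : ℝ → EuclideanSpace ℝ (Fin 3) → EuclideanSpace ℝ (Fin 3))
        (p : ℝ → EuclideanSpace ℝ (Fin 3) → ℝ),
        IsClassicalNSSolutionOn (Ico 0 a) ν 0 u p ∧ u 0 = 0 ∧
          (∀ t ∈ Ico 0 a, IsLatticePeriodic (u t)) ∧
          (∀ y, Tendsto (fun t => ‖u t y‖) (𝓝[<] a) atTop) ∧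
          (¬ ∃ (u' : ℝ → EuclideanSpace ℝ (Fin 3) → EuclideanSpace ℝ (Fin 3))
              (p' : ℝ → EuclideanSpace ℝ (Fin 3) → ℝ),
              IsSmoothOnHalfSpace u' ∧ IsSmoothOnHalfSpace p' ∧ IsNavierStokesSolution ν 0 0 u' p' ∧
                ∀ t ∈ Ico 0 a, u' t = u t ∧ p' t = p t) ∧
          ∃ (v : ℝ → EuclideanSpace ℝ (Fin 3) → EuclideanSpace ℝ (Fin 3))
            (q : ℝ → EuclideanSpace ℝ (Fin 3) → ℝ),
            IsSmoothOnHalfSpace v ∧ IsSmoothOnHalfSpace q ∧ IsNavierStokesSolution ν 0 0 v q ∧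
              ∀ t, 0 ≤ t → IsLatticePeriodic (v t) ∧ IsLatticePeriodic (q t))

/-- **The barrier holds** (all three conjuncts are tree theorems:
`setOf_periodicSolution_infinite` with `w = e₁`, `isLatticePeriodic_galileanBoost_pressure_iff`,
`exists_periodic_nonContinuable_and_global`). [cite: Tao2013Localisation, §1 (after Prop. 1.7), §3 eq. (galilean), §4 ¶1] -/
theorem unnormalisedPressureLoophole_holds : UnnormalisedPressureLoophole := by
  refine ⟨fun ν u₀ u p hns hu hp hper => ?_,
    fun p t ξ g hp => isLatticePeriodic_galileanBoost_pressure_iff hp ξ g,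
    fun ν a ha => exists_periodic_nonContinuable_and_global ν ha⟩
  have hw : (EuclideanSpace.single (0 : Fin 3) (1 : ℝ) : EuclideanSpace ℝ (Fin 3)) ≠ 0 := by
    intro h
    have := congrArg (fun v : EuclideanSpace ℝ (Fin 3) => v 0) h
    simp at this
  exact setOf_periodicSolution_infinite hns hu hp hper hw

/-- `UnnormalisedPressureLoophole` — `_holds` alias of `unnormalisedPressureLoophole_holds` above under the fact's exact name (appended
2026-08-28, D-0026 bookkeeping: the proof term is the existing theorem of this file; no statement,
definition or attribute is edited; no new named fact; the ledger's debt table listed the fact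
unproved). [cite: Tao2013Localisation, §1 (after Prop. 1.7), §3 eq. (galilean), §4 ¶1] -/
theorem _root_.Literature.Barriers.NavierStokesRegularity.UnnormalisedPressureLoophole_holds :
    UnnormalisedPressureLoophole :=
  _root_.Literature.Barriers.NavierStokesRegularity.unnormalisedPressureLoophole_holds

/-- Projection (i): non-uniqueness in the printed periodic class.
[cite: Tao2013Localisation, §1 (after Prop. 1.7) and §4 ¶1] -/
theorem UnnormalisedPressureLoophole.nonunique (h : UnnormalisedPressureLoophole) {ν : ℝ}
    {u₀ : EuclideanSpace ℝ (Fin 3) → EuclideanSpace ℝ (Fin 3)}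
    {u : ℝ → EuclideanSpace ℝ (Fin 3) → EuclideanSpace ℝ (Fin 3)} {p : ℝ → EuclideanSpace ℝ (Fin 3) → ℝ}
    (hns : IsNavierStokesSolution ν 0 u₀ u p) (hu : IsSmoothOnHalfSpace u) (hp : IsSmoothOnHalfSpace p)
    (hper : ∀ t, 0 ≤ t → IsLatticePeriodic (u t)) :
    {q : (ℝ → EuclideanSpace ℝ (Fin 3) → EuclideanSpace ℝ (Fin 3)) × (ℝ → EuclideanSpace ℝ (Fin 3) → ℝ) |
      IsSmoothOnHalfSpace q.1 ∧ IsSmoothOnHalfSpace q.2 ∧ IsNavierStokesSolution ν 0 u₀ q.1 q.2 ∧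
        ∀ t, 0 ≤ t → IsLatticePeriodic (q.1 t)}.Infinite :=
  h.1 ν u₀ u p hns hu hp hper

/-- Projection (ii): the errata class admits no accelerated frame.
[cite: Tao2013Localisation, §3 eq. (galilean)] -/
theorem UnnormalisedPressureLoophole.pressure_periodic_iff (h : UnnormalisedPressureLoophole)
    {p : ℝ → EuclideanSpace ℝ (Fin 3) → ℝ} {t : ℝ} (hp : IsLatticePeriodic (p t))
    (ξ : ℝ → EuclideanSpace ℝ (Fin 3)) (g : ℝ → ℝ) :
    IsLatticePeriodic ((fun s y => p s (y + ξ s) + ⟪deriv (deriv ξ) s, y⟫ - g s) t) ↔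
      deriv (deriv ξ) t = 0 :=
  h.2.1 p t ξ g hp

/-- Projection (iii): a non-continuable smooth periodic solution coexisting with a global one, at
zero datum. [cite: Tao2013Localisation, §3 eq. (galilean)] -/
theorem UnnormalisedPressureLoophole.nonContinuable_and_global (h : UnnormalisedPressureLoophole)
    (ν : ℝ) {a : ℝ} (ha : 0 < a) :
    ∃ (u : ℝ → EuclideanSpace ℝ (Fin 3) → EuclideanSpace ℝ (Fin 3))
      (p : ℝ → EuclideanSpace ℝ (Fin 3) → ℝ),
      IsClassicalNSSolutionOn (Ico 0 a) ν 0 u p ∧ u 0 = 0 ∧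
        (∀ t ∈ Ico 0 a, IsLatticePeriodic (u t)) ∧
        (∀ y, Tendsto (fun t => ‖u t y‖) (𝓝[<] a) atTop) ∧
        (¬ ∃ (u' : ℝ → EuclideanSpace ℝ (Fin 3) → EuclideanSpace ℝ (Fin 3))
            (p' : ℝ → EuclideanSpace ℝ (Fin 3) → ℝ),
            IsSmoothOnHalfSpace u' ∧ IsSmoothOnHalfSpace p' ∧ IsNavierStokesSolution ν 0 0 u' p' ∧
              ∀ t ∈ Ico 0 a, u' t = u t ∧ p' t = p t) ∧
        ∃ (v : ℝ → EuclideanSpace ℝ (Fin 3) → EuclideanSpace ℝ (Fin 3))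
          (q : ℝ → EuclideanSpace ℝ (Fin 3) → ℝ),
          IsSmoothOnHalfSpace v ∧ IsSmoothOnHalfSpace q ∧ IsNavierStokesSolution ν 0 0 v q ∧
            ∀ t, 0 ≤ t → IsLatticePeriodic (v t) ∧ IsLatticePeriodic (q t) :=
  h.2.2 ν a ha

end Literature.Barriers.NavierStokesRegularity

end
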